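import Mathlib
import Literature.NumberTheory.Transcendental.KZHyperbolicLadder
import Literature.NumberTheory.Transcendental.KZCalculusProofs
import Summits.KontsevichZagierPeriods.KontsevichZagierPeriods.Theorems.HyperbolicBlochOffTetraSectorKernelRungZeroIntervals
import Summits.KontsevichZagierPeriods.KontsevichZagierPeriods.Theorems.HyperbolicBlochOffTetraSectorKernelRungZeroInjectivity
import Summits.KontsevichZagierPeriods.KontsevichZagierPeriods.Theorems.HyperbolicBlochOffTetraSectorKernelRungZeroLogRelations

/-!
# `OffTetraSectorKernel` (stmt-KontsevichZagierPeriods-10557), line `odd-hyperbolic-ladder`: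
# rung `0` of the hyperbolic scissors ladder closes

Stub `stub_rungZero`: every `ℤ`-value-relator of rung `0` (`KZ.rungRelators 0`) is a
Kontsevich–Zagier relation. This is the composition of three landed ingredients:

* `isGeodesicPolytope_zero_eq_interval` — a rung-`0` polytope of `ℍ¹ = {t > 0}` is an interval
  `{α < t < β}` with real-algebraic end points `0 < α ≤ β`;
* `rungZero_setIntegral_hypDensity_interval` — its hyperbolic length is `log (β/α)`, so the value
  of any admissible representation `[P, dt/t]` is `log (β/α)`;
* `interval_log_relation_mem_relations` — a `ℤ`-relation `Σ mᵢ log (βᵢ/αᵢ) = 0` among such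
  lengths is a relation among the representations `[{αᵢ < t < βᵢ}, dt/t]` (exponentiate to the
  exact multiplicative relation; dissections and dilations are moves).

References: M. Kontsevich, D. Zagier, *Periods* (2001), §1.2; A. B. Goncharov, *Volumes of
hyperbolic manifolds and mixed Tate motives* (1999), §1.7.
-/

noncomputable section

open Set MeasureTheory
open Literature.NumberTheory.Transcendental

namespace Summit.KontsevichZagierPeriods.HyperbolicBloch.OffTetraSectorKernel

/-- The value of an admissible rung-`0` representation on a rung-`0` polytope `P = {α < t < β}`
(`0 < α ≤ β`) is the hyperbolic length `log (β/α)`. [cite: KontsevichZagier2001, §1.1] -/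
theorem rungZero_close_value_eq_log {ρ : Set (Fin (0 + 1) → ℝ) → KZ.IntegralRep (0 + 1)}
    (hρ : KZ.IsLadderFamily 0 ρ) {P : Set (Fin (0 + 1) → ℝ)} (hP : KZ.IsGeodesicPolytope 0 P)
    {α β : ℝ} (hα : 0 < α) (hαβ : α ≤ β) (hPe : P = {p : Fin 1 → ℝ | α < p 0 ∧ p 0 < β}) :
    (ρ P).value = Real.log (β / α) := by
  obtain ⟨hdom, heq⟩ := hρ P hP
  have hmeas : MeasurableSet P := hdom ▸ KZ.IntegralRep.measurableSet_domain_holds (ρ P)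
  rw [KZ.IntegralRep.value, hdom, setIntegral_congr_fun hmeas heq, hPe]
  exact rungZero_setIntegral_hypDensity_interval hα hαβ

/-- **Rung `0` of the hyperbolic scissors ladder closes unconditionally**: every `ℤ`-value-relator
among rung-`0` polytopes (intervals `{α < t < β}`, `0 < α ≤ β` algebraic:
`isGeodesicPolytope_zero_eq_interval`; values `log(β/α)`:
`rungZero_setIntegral_hypDensity_interval`) is a relation (`interval_log_relation_mem_relations`).
[cite: KontsevichZagier2001, §1.2] -/
theorem stub_rungZero : KZ.rungRelators 0 ⊆ (KZ.relations : Set KZ.FormalRep) := by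
  rintro d ⟨ρ, hρ, k, P, m, hP, hsum, rfl⟩
  choose α β hα hαβ halgα halgβ hPe using fun i => isGeodesicPolytope_zero_eq_interval (P i) (hP i)
  have hval : ∀ i, (ρ (P i)).value = Real.log (β i / α i) := fun i =>
    rungZero_close_value_eq_log hρ (hP i) (hα i) (hαβ i) (hPe i)
  simp only [hval] at hsum
  refine interval_log_relation_mem_relations k α β m (fun i => ρ (P i)) hα hαβ halgα halgβ
    (fun i => ?_) hsum
  obtain ⟨hdom, heq⟩ := hρ (P i) (hP i)
  refine ⟨hdom.trans (hPe i), fun p hp => ?_⟩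
  have hp' : p ∈ P i := by rwa [hdom] at hp
  rw [heq hp', rungZero_hypDensity_eq]
  simp only [one_div]

end Summit.KontsevichZagierPeriods.HyperbolicBloch.OffTetraSectorKernel

end
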